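import Summits.Schanuel.Schanuel.Theorems.RootDecomp1BTwoStorey05

/-!
# RootDecomp1BTwoStorey — lens 4, generation 43 «TWO-PARAMETER RADICAL DESCENT: STOREY THREE AT (1, ρ, σ)» (lane B-R26 (e); CLAIM L2197, ACK/CHECKLIST B-g43 L2199, NODE L2206 / REQUEST L2207, writer re-check L2211, critic VERDICT L2210: CLEARED — ONE CELL (lane (e) «m = 3 storeys»; engine VARIANT-REACH+ of g30, class NEW-LOCAL, territory NEW); RULE B-R29; lens-4 tally THEOREM ×7 + CELL ×4) — continuation (RootDecomp1BTwoStorey06): §D part 2 — THE KERNEL `algebraicIndependent_radical₂`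

(lens-4 g43 HOME kernel K = HOME/decomp-schanuel-lens-4/g43/TwoStorey.lean 24f29895…, 1683 l; VERDICT L2210 PORT GO; port by census-1 gen 19 as `RootDecomp1BTwoStorey01`–`06`: 01 = §A formal algebra + §B sizes; 02 = §D-data + §C part 1 (classes `UltraLiouville₂` / `JU`); 03 = §C part 2 (collision, two-dimensional non-vanishing, typed obstruction); 04 = §C part 3 (Baire density, controls); 05 = §D part 1: the CLASH ENGINE `radical₂_clash` (steps (2)–(5) of the g43 kernel proof stated on their own — census CAP EDITION, HAND-BACK L2252 / critic CONCUR L2253 under RESHAPE RULE L1684: the kernel `algebraicIndependent_radical₂` was ONE 459-line declaration > the 400-line file cap); 06 = §D part 2: THE KERNEL `algebraicIndependent_radical₂` (statement BYTE-IDENTICAL to K; proof = K's steps (0)–(1) verbatim + `exact radical₂_clash …`); 07 = §E storey-three cells.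
PORT EDITS: class defs' docstrings tagged; private port copies of length lemmas kept private; §D re-cut for the cap (one new public lemma `radical₂_clash`, proof text moved verbatim modulo the abstraction of the eigenvalue as `Φ` with `‖Φ‖ ≤ q^J·Kl·dJ`; nine now-unused local `have`s of the kernel dropped); every other statement and proof verbatim. `--supports stmt-Schanuel-24622`; no census credit carried; rung 0 — nothing here proves Schanuel.)
-/

noncomputable section

open Complex

namespace Summit.Schanuel.Schanuel.Theorems.RootDecomp1BTwoStorey

open Summit.Schanuel.Schanuel.Theorems.RootDecomp1BRadicalDescent (resFin resFin_val powSubst powSubst_X_self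
  powSubst_eq_zero_iff QDiv qdiv_powSubst residue_lemma)

section Kernel
open MvPolynomial
open Summit.Schanuel.Schanuel.Theorems.RootDecomp1BRadicalDescent (UltraLiouville DExpMeasure exists_int_relation
  kernel_clash_ineq norm_mvaeval_le_mvlen totalDegree_det_le mvlen_det_le adjugate_bounds)
open Summit.Schanuel.Schanuel.Theorems.RootDecomp1KHyper (mvlen mvlen_nonneg abs_coeff_le_mvlen one_le_mvlen)
variable {n : ℕ}

set_option maxHeartbeats 1600000 in
/-- **KERNEL THEOREM (two-parameter radical descent).** Let `θ = (θ_1, …, θ_n)` carry a degree-uniform measure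
of algebraic independence `DExpMeasure θ` (§B of `RootDecomp1BRadicalDescent02`; supplied for `θ = e^{y}`, `y`
algebraic `ℚ`-free, by the Lindemann–Weierstrass measure), let `e^{y₀} = θ_{i₀}`, and let `(ρ, σ)` be a positive,
JOINTLY ultra-Liouville, algebraically independent pair. Then `(e^{ρ y₀}, e^{σ y₀}, ρ, σ, θ_1, …, θ_n)` is
algebraically independent over `ℚ`.

Proof: an integer relation `P(e^{ρy₀}, e^{σy₀}, ρ, σ, θ) = 0` is specialised at the COMMON-denominator approximant
`(a/q, b/q)`; with ONE radical `s = e^{y₀/q}` (`s^q = θ_{i₀}`, `s^a = e^{(a/q) y₀}`, `s^b = e^{(b/q) y₀}`) the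
specialisation `Φ(s) = q^J P(s^a, s^b, a/q, b/q, θ)` is tiny (Lipschitz on `ℝ²`), it is an eigenvalue of the norm-form
matrix of `Σ_{k₁,k₂} C_{k₁k₂} T^{a k₁ + b k₂}` modulo `T^q − θ_{i₀}` (general exponent family, §A) — whose determinant
is a NONZERO integer polynomial in `θ` because the exponents `a k₁ + b k₂` are distinct mod `q` (KRONECKER COLLISION
LEMMA, from the `ℚ`-freeness of `(1, ρ, σ)`) and some `C_k ≠ 0` (TWO-DIMENSIONAL NON-VANISHING at `(a/q, b/q)`, from
the algebraic independence of `(ρ, σ)`) — and the measure at the FIXED point `θ` contradicts the eigen-factorisation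
bound for `q` large (`kernel_clash_ineq`, verbatim). Positivity of `ρ, σ` makes the numerators `a, b` natural.
(Census cap edition of the port, statement byte-identical: steps (2)–(5) of the g43 proof are the lemma
`radical₂_clash` above, applied at the end; steps (0)–(1) verbatim.) -/
theorem algebraicIndependent_radical₂ {θ : Fin n → ℂ} (hθ : DExpMeasure θ) (i₀ : Fin n) {y₀ : ℂ}
    (hy : cexp y₀ = θ i₀) {ρ σ : ℝ} (hρσ : UltraLiouville₂ ρ σ)
    (hai : AlgebraicIndependent ℚ ![(ρ : ℂ), (σ : ℂ)]) (hρ0 : 0 < ρ) (hσ0 : 0 < σ) :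
    AlgebraicIndependent ℚ
      (Fin.cons (cexp ((ρ : ℂ) * y₀)) (Fin.cons (cexp ((σ : ℂ) * y₀))
        (Fin.cons (ρ : ℂ) (Fin.cons (σ : ℂ) θ))) : Fin (n + 4) → ℂ) := by
  classical
  by_contra hdep
  obtain ⟨P, hP0, hPv⟩ := exists_int_relation hdep
  obtain ⟨A₀, hA₀⟩ := hθ
  -- degrees and the partial degrees in `U₁, U₂` (coordinates 0, 1) and `Y₁, Y₂` (coordinates 2, 3)
  set dP := P.totalDegree with hdP
  set K₁ := P.degreeOf 0 with hK₁def
  set K₂ := P.degreeOf 1 with hK₂def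
  set J := P.degreeOf 2 + P.degreeOf 3 with hJdef
  have hK₁ : ∀ s ∈ P.support, s 0 ≤ K₁ := fun s hs => monomial_le_degreeOf 0 hs
  have hK₂ : ∀ s ∈ P.support, s 1 ≤ K₂ := fun s hs => monomial_le_degreeOf 1 hs
  have hJ : ∀ s ∈ P.support, s 2 + s 3 ≤ J := fun s hs =>
    add_le_add (monomial_le_degreeOf 2 hs) (monomial_le_degreeOf 3 hs)
  -- the C¹ function F on ℝ², its root (ρ, σ) and a local Lipschitz constant
  have hF : Frel₂ P θ y₀ (ρ, σ) = 0 := by rw [Frel₂_eq_aeval]; exact hPv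
  obtain ⟨Kl, δ₁, hKl, hδ₁, hLip⟩ := exists_lipschitz_Frel₂ P θ y₀ (ρ, σ)
  -- the fibre polynomial μ ∈ ℤ[Y₁, Y₂] of a monomial s₀ of P (guarantees some `C_k ≠ 0` after specialisation)
  obtain ⟨s₀, hs₀⟩ : ∃ s₀, s₀ ∈ P.support := by
    obtain ⟨t, ht⟩ := MvPolynomial.ne_zero_iff.mp hP0
    exact ⟨t, mem_support_iff.mpr ht⟩
  set k₀ : ℕ × ℕ := (s₀ 0, s₀ 1) with hk₀
  set m₀ : Fin n →₀ ℕ := sX4 s₀ with hm₀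
  obtain ⟨μ, hμ⟩ : ∃ μ : MvPolynomial (Fin 2) ℤ, μ =
    ∑ s ∈ P.support with (((s 0, s 1) : ℕ × ℕ) = k₀ ∧ sX4 s = m₀),
      monomial (Finsupp.single 0 (s 2) + Finsupp.single 1 (s 3)) (P.coeff s) := ⟨_, rfl⟩
  have hμ0 : μ ≠ 0 := by
    intro h
    have hc : μ.coeff (Finsupp.single 0 (s₀ 2) + Finsupp.single 1 (s₀ 3)) = P.coeff s₀ := by
      rw [hμ, coeff_sum]
      simp only [coeff_monomial]
      rw [Finset.sum_eq_single s₀]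
      · rw [if_pos rfl]
      · intro s hs hne
        have hs' := (Finset.mem_filter.1 hs).2
        rw [if_neg]
        intro h1
        have h2 := congrArg (fun f : Fin 2 →₀ ℕ => f 0) h1
        have h3 := congrArg (fun f : Fin 2 →₀ ℕ => f 1) h1
        simp only [Finsupp.coe_add, Pi.add_apply, Finsupp.single_eq_same, Finsupp.single_eq_of_ne (show (0 : Fin 2) ≠ 1 by decide),
          Finsupp.single_eq_of_ne (show (1 : Fin 2) ≠ 0 by decide), add_zero, zero_add] at h2 h3
        have h4 : s 0 = s₀ 0 := congrArg Prod.fst hs'.1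
        have h5 : s 1 = s₀ 1 := congrArg Prod.snd hs'.1
        exact hne (eq_of_parts4 h4 h5 h2 h3 hs'.2)
      · intro h'
        exact absurd (Finset.mem_filter.2 ⟨hs₀, rfl, rfl⟩) h'
    rw [h, coeff_zero] at hc
    exact (mem_support_iff.1 hs₀) hc.symm
  obtain ⟨δ₀, hδ₀, hμball⟩ := exists_ball_aeval_ne_zero₂ hai μ hμ0
  have hμeval : ∀ x₁ x₂ : ℂ, aeval ![x₁, x₂] μ =
      ∑ s ∈ P.support with (((s 0, s 1) : ℕ × ℕ) = k₀ ∧ sX4 s = m₀),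
        ((P.coeff s : ℤ) : ℂ) * (x₁ ^ (s 2) * x₂ ^ (s 3)) := by
    intro x₁ x₂
    rw [hμ, map_sum]
    refine Finset.sum_congr rfl fun s _ => ?_
    rw [aeval_monomial, algebraMap_int_eq, eq_intCast, Finsupp.prod_fintype _ _ (fun _ => by simp),
      Fin.prod_univ_two]
    simp [Finsupp.single_eq_of_ne (show (0 : Fin 2) ≠ 1 by decide),
      Finsupp.single_eq_of_ne (show (1 : Fin 2) ≠ 0 by decide)]
  -- the Kronecker collision threshold for the box  max K₁ K₂
  have hli := linearIndependent_one_of_algebraicIndependent hai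
  obtain ⟨ε, hε, hcoll⟩ := collision_free hli (max K₁ K₂)
  -- q-independent sizes
  set Θ : ℝ := 1 + ∑ i, ‖θ i‖ with hΘ
  have hsum0 : 0 ≤ ∑ i, ‖θ i‖ := Finset.sum_nonneg fun i _ => norm_nonneg (θ i)
  have hΘ1 : 1 ≤ Θ := by rw [hΘ]; linarith
  have hθΘ : ∀ i, ‖θ i‖ ≤ Θ := fun i => by
    have := Finset.single_le_sum (fun j (_ : j ∈ Finset.univ) => norm_nonneg (θ j)) (Finset.mem_univ i)
    rw [hΘ]; linarith
  set Bρ : ℕ := ⌈ρ⌉₊ + 1 with hBρ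
  have hBρ1 : ρ + 1 ≤ Bρ := by rw [hBρ]; push_cast; linarith [Nat.le_ceil ρ]
  set Bσ : ℕ := ⌈σ⌉₊ + 1 with hBσ
  have hBσ1 : σ + 1 ≤ Bσ := by rw [hBσ]; push_cast; linarith [Nat.le_ceil σ]
  set δe : ℕ := dP + (Bρ * K₁ + Bσ * K₂) with hδe
  set LP : ℤ := mvlen P with hLP
  have hLP1 : 1 ≤ LP := one_le_mvlen hP0
  set A : ℕ := A₀ + 1 with hA
  set α : ℝ := A * ((δe : ℝ) + 1) ^ A with hα
  set cE : ℝ := ((K₁ : ℝ) + 1) * ((K₂ : ℝ) + 1) + LP + J * ((Bρ : ℝ) + Bσ + 1) with hcE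
  set cN : ℝ := cE + 2 with hcN
  set cU : ℝ := ((J : ℝ) + 2) + cE + Θ * ((δe : ℝ) + 1) with hcU
  set c₃ : ℝ := (Kl + 1) + cU + cN with hc₃
  -- thresholds and the common-denominator approximant (a/q, b/q)
  set δs : ℝ := min (min δ₀ δ₁) (min (min ε 1) (min ρ σ)) with hδs
  have hδs0 : 0 < δs := lt_min (lt_min hδ₀ hδ₁) (lt_min (lt_min hε one_pos) (lt_min hρ0 hσ0))
  obtain ⟨Q₁, hQ₁⟩ := exists_nat_gt (c₃ + 2 + α)
  obtain ⟨Q₂, hQ₂⟩ := exists_nat_gt (-Real.log δs)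
  obtain ⟨q, aZ, bZ, hqQ, hq1, hρa, hσb⟩ := hρσ.exists_ge (A + 1) (max Q₁ Q₂)
  have hqQ₁ : Q₁ ≤ q := (le_max_left _ _).trans hqQ
  have hqQ₂ : Q₂ ≤ q := (le_max_right _ _).trans hqQ
  have hq : 0 < q := by omega
  have hq1r : (1 : ℝ) ≤ q := by exact_mod_cast hq
  have hq0r : (0 : ℝ) < q := by positivity
  -- the approximation is within δs
  have hsmall : Real.exp (-Real.exp ((q : ℝ) ^ (A + 1))) < δs := by
    have h1 : (q : ℝ) ≤ (q : ℝ) ^ (A + 1) := le_self_pow₀ hq1r (by omega)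
    have h2 : (q : ℝ) ^ (A + 1) + 1 ≤ Real.exp ((q : ℝ) ^ (A + 1)) := Real.add_one_le_exp _
    have h3 : (Q₂ : ℝ) ≤ q := by exact_mod_cast hqQ₂
    rw [← Real.exp_log hδs0, Real.exp_lt_exp]
    linarith
  have hρa' : |ρ - (aZ : ℝ) / q| < δs := hρa.trans hsmall
  have hσb' : |σ - (bZ : ℝ) / q| < δs := hσb.trans hsmall
  -- positivity: the numerators are natural numbers
  have haZ0 : 0 ≤ aZ := by
    have h1 : |ρ - (aZ : ℝ) / q| < ρ := hρa'.trans_le ((min_le_right _ _).trans ((min_le_right _ _).trans (min_le_left _ _)))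
    have h2 : (0 : ℝ) < (aZ : ℝ) / q := by have := abs_lt.1 h1; linarith
    have h3 : (0 : ℝ) < aZ := by
      have := div_pos_iff.1 h2
      rcases this with h | h
      · exact h.1
      · linarith [h.2]
    exact_mod_cast h3.le
  have hbZ0 : 0 ≤ bZ := by
    have h1 : |σ - (bZ : ℝ) / q| < σ := hσb'.trans_le ((min_le_right _ _).trans ((min_le_right _ _).trans (min_le_right _ _)))
    have h2 : (0 : ℝ) < (bZ : ℝ) / q := by have := abs_lt.1 h1; linarith
    have h3 : (0 : ℝ) < bZ := by
      have := div_pos_iff.1 h2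
      rcases this with h | h
      · exact h.1
      · linarith [h.2]
    exact_mod_cast h3.le
  set a : ℕ := aZ.toNat with hadef
  set b : ℕ := bZ.toNat with hbdef
  have haZ : (a : ℤ) = aZ := Int.toNat_of_nonneg haZ0
  have hbZ : (b : ℤ) = bZ := Int.toNat_of_nonneg hbZ0
  have haR : (aZ : ℝ) = (a : ℝ) := by rw [← haZ]; rfl
  have hbR : (bZ : ℝ) = (b : ℝ) := by rw [← hbZ]; rfl
  rw [haR] at hρa hρa'
  rw [hbR] at hσb hσb'
  have hρa₀₁ : |ρ - (a : ℝ) / q| < 1 :=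
    hρa'.trans_le ((min_le_right _ _).trans ((min_le_left _ _).trans (min_le_right _ _)))
  have hσb₀₁ : |σ - (b : ℝ) / q| < 1 :=
    hσb'.trans_le ((min_le_right _ _).trans ((min_le_left _ _).trans (min_le_right _ _)))
  have hρaε : |ρ - (a : ℝ) / q| < ε :=
    hρa'.trans_le ((min_le_right _ _).trans ((min_le_left _ _).trans (min_le_left _ _)))
  have hσbε : |σ - (b : ℝ) / q| < ε :=
    hσb'.trans_le ((min_le_right _ _).trans ((min_le_left _ _).trans (min_le_left _ _)))
  have haB : a ≤ Bρ * q := by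
    have h1 : (a : ℝ) / q < ρ + 1 := by have := abs_lt.1 hρa₀₁; linarith
    have h2 : (a : ℝ) / q < Bρ := by linarith
    have h3 : (a : ℝ) < Bρ * q := by rwa [div_lt_iff₀ hq0r] at h2
    exact_mod_cast h3.le
  have hbB : b ≤ Bσ * q := by
    have h1 : (b : ℝ) / q < σ + 1 := by have := abs_lt.1 hσb₀₁; linarith
    have h2 : (b : ℝ) / q < Bσ := by linarith
    have h3 : (b : ℝ) < Bσ * q := by rwa [div_lt_iff₀ hq0r] at h2
    exact_mod_cast h3.le
  -- the distance of the approximant in ℝ²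
  have hdistle : dist (((a : ℝ) / q, (b : ℝ) / q) : ℝ × ℝ) (ρ, σ) ≤ Real.exp (-Real.exp ((q : ℝ) ^ (A + 1))) := by
    rw [Prod.dist_eq, Real.dist_eq, Real.dist_eq]
    exact max_le (by rw [abs_sub_comm]; exact hρa.le) (by rw [abs_sub_comm]; exact hσb.le)
  have hdist₀ : dist (((a : ℝ) / q, (b : ℝ) / q) : ℝ × ℝ) (ρ, σ) < δ₀ :=
    hdistle.trans_lt (hsmall.trans_le ((min_le_left _ _).trans (min_le_left _ _)))
  have hdist₁ : dist (((a : ℝ) / q, (b : ℝ) / q) : ℝ × ℝ) (ρ, σ) < δ₁ :=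
    hdistle.trans_lt (hsmall.trans_le ((min_le_left _ _).trans (min_le_right _ _)))
  -- the radical s = e^{y₀/q}
  obtain ⟨s, hsdef⟩ : ∃ s : ℂ, s = cexp (y₀ / q) := ⟨_, rfl⟩
  have hqC : (q : ℂ) ≠ 0 := by exact_mod_cast hq.ne'
  have hsq : s ^ q = θ i₀ := by
    rw [hsdef, ← Complex.exp_nat_mul, mul_div_cancel₀ _ hqC, hy]
  have hsa : s ^ a = cexp (((((a : ℝ) / q : ℝ)) : ℂ) * y₀) := by
    rw [hsdef, ← Complex.exp_nat_mul]
    congr 1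
    push_cast
    field_simp
  have hsb : s ^ b = cexp (((((b : ℝ) / q : ℝ)) : ℂ) * y₀) := by
    rw [hsdef, ← Complex.exp_nat_mul]
    congr 1
    push_cast
    field_simp
  have hsΘ : ‖s‖ ≤ Θ := by
    by_contra h
    push Not at h
    have h1 : 1 ≤ ‖s‖ := hΘ1.trans h.le
    have h2 : ‖s‖ ≤ ‖s‖ ^ q := le_self_pow₀ h1 (by omega)
    have h3 : ‖s‖ ^ q = ‖θ i₀‖ := by rw [← norm_pow, hsq]
    linarith [hθΘ i₀]
  -- some C_k is nonzero: C_{k₀} has the coefficient q^J μ(a/q, b/q) ≠ 0 at m₀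
  have hC : ∃ k ∈ Finset.range (K₁ + 1) ×ˢ Finset.range (K₂ + 1), Cf₂ P a b q J k ≠ 0 := by
    refine ⟨k₀, Finset.mem_product.2 ⟨Finset.mem_range.2 (Nat.lt_succ_of_le (hK₁ s₀ hs₀)),
      Finset.mem_range.2 (Nat.lt_succ_of_le (hK₂ s₀ hs₀))⟩, fun h0 => ?_⟩
    have hcoef : (Cf₂ P a b q J k₀).coeff m₀ =
        ∑ s ∈ P.support with (((s 0, s 1) : ℕ × ℕ) = k₀ ∧ sX4 s = m₀),
          P.coeff s * (a : ℤ) ^ (s 2) * (b : ℤ) ^ (s 3) * (q : ℤ) ^ (J - s 2 - s 3) := by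
      rw [Cf₂, coeff_sum]
      simp only [coeff_monomial]
      rw [Finset.sum_filter, Finset.sum_filter]
      refine Finset.sum_congr rfl fun s _ => ?_
      by_cases h1 : ((s 0, s 1) : ℕ × ℕ) = k₀ <;> by_cases h2 : sX4 s = m₀ <;> simp [h1, h2]
    have hcast : (((Cf₂ P a b q J k₀).coeff m₀ : ℤ) : ℂ) =
        (q : ℂ) ^ J * aeval ![(((((a : ℝ) / q : ℝ)) : ℂ)), (((((b : ℝ) / q : ℝ)) : ℂ))] μ := by
      rw [hcoef, hμeval, Finset.mul_sum]
      push_cast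
      refine Finset.sum_congr rfl fun s hs => ?_
      have hs23 : s 2 + s 3 ≤ J := hJ s (Finset.mem_filter.1 hs).1
      obtain ⟨t, ht⟩ : ∃ t, t = J - s 2 - s 3 := ⟨_, rfl⟩
      rw [← ht]
      have hJt : J = t + s 2 + s 3 := by omega
      rw [hJt, pow_add, pow_add, div_pow, div_pow]
      field_simp
    have hμr : aeval ![(((((a : ℝ) / q : ℝ)) : ℂ)), (((((b : ℝ) / q : ℝ)) : ℂ))] μ ≠ 0 :=
      hμball (((a : ℝ) / q, (b : ℝ) / q)) hdist₀
    have : (((Cf₂ P a b q J k₀).coeff m₀ : ℤ) : ℂ) = 0 := by rw [h0, coeff_zero, Int.cast_zero]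
    rw [hcast] at this
    exact (mul_ne_zero (pow_ne_zero _ hqC) hμr) this
  -- the exponents a k₁ + b k₂ are distinct mod q on the box (Kronecker collision lemma)
  have he : ∀ k ∈ Finset.range (K₁ + 1) ×ˢ Finset.range (K₂ + 1),
      ∀ k' ∈ Finset.range (K₁ + 1) ×ˢ Finset.range (K₂ + 1),
        (a * k.1 + b * k.2) % q = (a * k'.1 + b * k'.2) % q → k = k' := by
    intro k hk k' hk' hkk
    obtain ⟨hk1, hk2⟩ := Finset.mem_product.1 hk
    obtain ⟨hk1', hk2'⟩ := Finset.mem_product.1 hk'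
    have h1 : k.1 ≤ max K₁ K₂ := (Nat.le_of_lt_succ (Finset.mem_range.1 hk1)).trans (le_max_left _ _)
    have h2 : k.2 ≤ max K₁ K₂ := (Nat.le_of_lt_succ (Finset.mem_range.1 hk2)).trans (le_max_right _ _)
    have h1' : k'.1 ≤ max K₁ K₂ := (Nat.le_of_lt_succ (Finset.mem_range.1 hk1')).trans (le_max_left _ _)
    have h2' : k'.2 ≤ max K₁ K₂ := (Nat.le_of_lt_succ (Finset.mem_range.1 hk2')).trans (le_max_right _ _)
    have := hcoll q a b hq hρaε hσbε k.1 k.2 k'.1 k'.2 h1 h2 h1' h2' hkk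
    exact Prod.ext this.1 this.2
  -- the norm form N = det M ≠ 0 and its evaluation
  obtain ⟨M, hMdef⟩ : ∃ M : Matrix (Fin q) (Fin q) (MvPolynomial (Fin n) ℤ),
      M = radMatG (Finset.range (K₁ + 1) ×ˢ Finset.range (K₂ + 1)) (Cf₂ P a b q J)
        (fun k => a * k.1 + b * k.2) hq i₀ := ⟨_, rfl⟩
  obtain ⟨N, hNdef⟩ : ∃ N : MvPolynomial (Fin n) ℤ, N = M.det := ⟨_, rfl⟩
  have hN0 : N ≠ 0 := by
    rw [hNdef, hMdef]; exact det_radMatG_ne_zero i₀ q _ (Cf₂ P a b q J) _ hq he hC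
  obtain ⟨f, hfdef⟩ : ∃ f : MvPolynomial (Fin n) ℤ →+* ℂ, f = (MvPolynomial.aeval θ).toRingHom :=
    ⟨_, rfl⟩
  have hf : ∀ Q : MvPolynomial (Fin n) ℤ, f Q = aeval θ Q := fun Q => by rw [hfdef]; rfl
  obtain ⟨Mθ, hMθ⟩ : ∃ Mθ : Matrix (Fin q) (Fin q) ℂ, Mθ = f.mapMatrix M := ⟨_, rfl⟩
  have hMθ_apply : ∀ l a', Mθ l a' = aeval θ (M l a') := fun l a' => by
    rw [hMθ, RingHom.mapMatrix_apply, Matrix.map_apply, hf]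
  have hdet : Mθ.det = aeval θ N := by rw [hMθ, ← RingHom.map_det, hf, hNdef]
  have hadj : ∀ a' : Fin q, Mθ.adjugate ⟨0, hq⟩ a' = aeval θ (M.adjugate ⟨0, hq⟩ a') := by
    intro a'
    rw [hMθ, ← RingHom.map_adjugate, RingHom.mapMatrix_apply, Matrix.map_apply, hf]
  -- entry bounds
  have hcard : (((Finset.range (K₁ + 1) ×ˢ Finset.range (K₂ + 1)).card : ℕ) : ℤ) =
      ((K₁ : ℤ) + 1) * ((K₂ : ℤ) + 1) := by
    rw [Finset.card_product, Finset.card_range, Finset.card_range]; push_cast; ring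
  obtain ⟨E, hEdef⟩ : ∃ E : ℤ, E = (((K₁ : ℤ) + 1) * ((K₂ : ℤ) + 1)) * (LP * ((a : ℤ) + b + q) ^ J) :=
    ⟨_, rfl⟩
  have hE1 : 1 ≤ E := by
    have h1 : (1 : ℤ) ≤ ((K₁ : ℤ) + 1) * ((K₂ : ℤ) + 1) := by
      have := Int.natCast_nonneg K₁; have := Int.natCast_nonneg K₂; nlinarith
    have h2 : (1 : ℤ) ≤ ((a : ℤ) + b + q) ^ J :=
      one_le_pow₀ (by linarith [Int.natCast_nonneg a, Int.natCast_nonneg b, show (1:ℤ) ≤ q by exact_mod_cast hq])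
    rw [hEdef]
    calc (1 : ℤ) = 1 * (1 * 1) := by ring
      _ ≤ (((K₁ : ℤ) + 1) * ((K₂ : ℤ) + 1)) * (LP * ((a : ℤ) + b + q) ^ J) :=
          mul_le_mul h1 (mul_le_mul hLP1 h2 zero_le_one (by linarith)) (by norm_num) (by linarith)
  have hentry : ∀ l a', mvlen (M l a') ≤ E := fun l a' => by
    rw [hMdef, hEdef, ← hcard]
    exact mvlen_radMatG_le _ (Cf₂ P a b q J) _ hq i₀ (fun k _ => mvlen_Cf₂_le P a b q J hJ k)
      (mul_nonneg (mvlen_nonneg P) (pow_nonneg (by positivity) _)) l a'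
  have hentry' : ∀ l a', (M l a').totalDegree ≤ δe := fun l a' => by
    rw [hMdef]
    refine totalDegree_radMatG_le _ (Cf₂ P a b q J) _ hq i₀ (d := dP) (D := Bρ * K₁ + Bσ * K₂)
      (fun k _ => totalDegree_Cf₂_le P a b q J k) (fun k hk => ?_) l a'
    obtain ⟨hk1, hk2⟩ := Finset.mem_product.1 hk
    have h1 : k.1 ≤ K₁ := Nat.le_of_lt_succ (Finset.mem_range.1 hk1)
    have h2 : k.2 ≤ K₂ := Nat.le_of_lt_succ (Finset.mem_range.1 hk2)
    calc a * k.1 + b * k.2 ≤ (Bρ * q) * K₁ + (Bσ * q) * K₂ :=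
          add_le_add (Nat.mul_le_mul haB h1) (Nat.mul_le_mul hbB h2)
      _ = q * (Bρ * K₁ + Bσ * K₂) := by ring
  have hNlen : mvlen N ≤ (q.factorial : ℤ) * E ^ q := by rw [hNdef]; exact mvlen_det_le M hentry
  have hNdeg : N.totalDegree ≤ q * δe := by rw [hNdef]; exact totalDegree_det_le M hentry'
  have hadjB : ∀ a' : Fin q, mvlen (M.adjugate ⟨0, hq⟩ a') ≤ (q.factorial : ℤ) * E ^ q ∧
      (M.adjugate ⟨0, hq⟩ a').totalDegree ≤ q * δe := fun a' => adjugate_bounds M hE1 hentry hentry' _ _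
  -- (1) the eigen factorisation  det Mθ = Φθ(s) · Σ_a adj 0 a s^a,  Φθ(s) = q^J F(a/q, b/q)
  have hfact := det_eq_eigen_mulG hq (Finset.range (K₁ + 1) ×ˢ Finset.range (K₂ + 1))
    (fun k => a * k.1 + b * k.2) (fun k => aeval θ (Cf₂ P a b q J k)) (θ i₀) s hsq Mθ (by
    intro l a'
    rw [hMθ_apply, hMdef]
    simp only [radMatG, map_sum, map_mul, map_pow, aeval_X])
  have heigen : ∑ k ∈ Finset.range (K₁ + 1) ×ˢ Finset.range (K₂ + 1),
      aeval θ (Cf₂ P a b q J k) * s ^ (a * k.1 + b * k.2) =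
      (q : ℂ) ^ J * Frel₂ P θ y₀ ((a : ℝ) / q, (b : ℝ) / q) :=
    eigen_eq_Frel₂ P a b q J θ y₀ hK₁ hK₂ hJ hq s hsa hsb
  -- the eigenvalue is small: ‖Φ‖ ≤ q^J · Kl · dist((a/q, b/q), (ρ, σ))
  have hΦ : ‖∑ k ∈ Finset.range (K₁ + 1) ×ˢ Finset.range (K₂ + 1),
      aeval θ (Cf₂ P a b q J k) * s ^ (a * k.1 + b * k.2)‖ ≤
      (q : ℝ) ^ J * (Kl * dist (((a : ℝ) / q, (b : ℝ) / q) : ℝ × ℝ) (ρ, σ)) := by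
    rw [heigen, norm_mul, norm_pow, Complex.norm_natCast]
    refine mul_le_mul_of_nonneg_left ?_ (by positivity)
    have := hLip ((a : ℝ) / q, (b : ℝ) / q) hdist₁
    rw [hF, sub_zero] at this
    exact this
  -- steps (2)–(5): the clash engine
  exact radical₂_clash hq hA₀ hN0 hdet hadj hE1 hNlen hNdeg hadjB hΘ1 hθΘ hsΘ hfact hKl dist_nonneg hΦ hA
    hdistle hLP1 haB hbB hEdef hcE hcN hcU hc₃ hα hQ₁ hqQ₁

end Kernel

end Summit.Schanuel.Schanuel.Theorems.RootDecomp1BTwoStorey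

end
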